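import Mathlib
import Literature.Analysis.FluidPDE.Tao2016AveragedNS.BoundedEternalSolutions
import Summits.NavierStokesRegularity.NavierStokesRegularity.Theorems.WakeRatchetExtractionAscoli
import HarnessLib

/-!
# Closure of the INVISCID eternal law under continuous limits of translates on receding half-lines —
  the ν = 0 compactness core of the extraction stub `stub_eternalFromBlowup` of K2(1)
  `TaoLadderRungTwoBreak.BlowupRigidityOne` (stmt-NavierStokesRegularity-20206)

MODEL lattice ODEs only (Tao 2016 §4 (4.8)/(4.12) written in the self-similar log-time variables of §6.4);
nothing here is a statement about the Navier–Stokes equations; NO item is closed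
(`--supports stmt-NavierStokesRegularity-20206`). Route-independent; general number of modes `m`.

The registered stub `stub_eternalFromBlowup` asks robust blow-up to produce `W : ℤ → ℝ → ℝ^4` satisfying the
law of `IsEternal ε₀ α` at EVERY log-time `σ ∈ ℝ` (plus admissibility and forward survival). The renormalised
robust blow-up satisfies that law only on a half-line `e^{-σ} < T⋆` (tree: `renormalisedFlow_law`,
`blowupProfile_of_noGlobalCascade`); an ETERNAL object can only be an ω-limit of its log-time / shell
translates. This file is the ODE-closure step of that passage, in the form the ν = 0 extraction needs and with
no clock, rate or centring baked in:

* `norm_eternalLaw_rhs_le` — the right-hand side of the inviscid eternal law is bounded by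
  `K(B) = B + s₀₀₀ B² + |Λ| s₀₀₁ B² + |Λ⁻¹| (s₁₀₀ + s₀₁₀) B²` on shell vectors of norm `≤ B`
  (`s_μ = shiftConst α μ`);
* `eternalLaw_of_continuousLimit` — **CLOSURE**: if `V_j : ℤ → ℝ → ℝ^m` solve the inviscid eternal law on the
  half-lines `(a_j, ∞)` with `a_j → -∞`, are bounded there by one constant `B`, and converge CONTINUOUSLY
  (`u_j → σ ⇒ V_j n u_j → W n σ`, the output form of the tree's Arzelà–Ascoli extraction
  `MinimalBlowupExtraction.Extraction.exists_subseq_continuousLimit`, kit of the proved ⟨22744⟩) to `W`, then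
  `W` solves the law of
  `IsEternal ε₀ α` at every `σ ∈ ℝ` and is bounded by `B`. Proof: uniform Lipschitz bound `K(B)` ⇒ `W`
  continuous; integral form of each `V_j` + dominated convergence ⇒ integral form of `W`; FTC.

Pattern adapted from the VISCOUS, clock-centred closure `…ClockedFrames.closureLaw_holds` of the proved extraction
⟨22744⟩ (route WakeRatchet), here stated for arbitrary translates and ν̂ = 0. What this does NOT give toward the
stub: the admissibility clauses `action`/`bdd` of `IsEternal` and `EternalSurvivingFwd 1` of a limit (they need
per-shell action / energy ceilings and a firing floor of the blow-up — the open (E2) data), and the type-I bound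
that feeds `B` (open, N-39).
-/

noncomputable section

-- the summit and its single sub-problem share the name (CONVENTIONS §1)
set_option linter.dupNamespace false

open Set Filter Topology MeasureTheory

namespace Summit.NavierStokesRegularity.NavierStokesRegularity.Theorems

namespace BlowupRigidityOne

open Literature.Analysis.FluidPDE Literature.Analysis.FluidPDE.TaoCascade
open Summit.NavierStokesRegularity.NavierStokesRegularity.Cruxes.MinimalBlowupExtraction.TableCont
  (tendsto_tableQ_comp tendsto_tableA_comp tendsto_tableB_comp)
open TransitMassLedgerEnergy (continuous_tableQ continuous_tableA continuous_tableB_comp)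

variable {m : ℕ}

/-- **The inviscid eternal vector field is bounded on bounded shells.** For shell vectors `x, y, z` of norm
`≤ B`, `‖-x + Q(x) + Λ A(y) + Λ⁻¹ B(z, x)‖ ≤ B + s₀₀₀ B² + ‖Λ‖ s₀₀₁ B² + ‖Λ⁻¹‖ (s₁₀₀ + s₀₁₀) B·B`
(`s_μ = shiftConst α μ`; the norm bounds `norm_tableQ_le` / `norm_tableA_le` / `norm_tableB_le`).
[cite: Tao2016AveragedNS, §4 (4.1), Lemma 4.1 (4.8); cell vocabulary (`shiftConst`)] -/
theorem norm_eternalLaw_rhs_le (ε₀ : ℝ) (α : Fin m → Fin m → Fin m → ℤ × ℤ × ℤ → ℝ) {B : ℝ}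
    (hB : 0 ≤ B) {x y z : Em m} (hx : ‖x‖ ≤ B) (hy : ‖y‖ ≤ B) (hz : ‖z‖ ≤ B) :
    ‖-((1 : ℝ) • x) + tableQ α x + bigLam ε₀ • tableA α y + (bigLam ε₀)⁻¹ • tableB α z x‖ ≤
      B + shiftConst α (0, 0, 0) * B ^ 2 + ‖bigLam ε₀‖ * (shiftConst α (0, 0, 1) * B ^ 2)
        + ‖(bigLam ε₀)⁻¹‖ * ((shiftConst α (1, 0, 0) + shiftConst α (0, 1, 0)) * B * B) := by
  have h1 : ‖-((1 : ℝ) • x)‖ ≤ B := by rw [norm_neg, one_smul]; exact hx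
  have h2 : ‖tableQ α x‖ ≤ shiftConst α (0, 0, 0) * B ^ 2 :=
    (norm_tableQ_le α _).trans (mul_le_mul_of_nonneg_left
      (pow_le_pow_left₀ (norm_nonneg _) hx 2) (shiftConst_nonneg α _))
  have h3 : ‖bigLam ε₀ • tableA α y‖ ≤ ‖bigLam ε₀‖ * (shiftConst α (0, 0, 1) * B ^ 2) := by
    rw [norm_smul]
    exact mul_le_mul_of_nonneg_left ((norm_tableA_le α _).trans (mul_le_mul_of_nonneg_left
      (pow_le_pow_left₀ (norm_nonneg _) hy 2) (shiftConst_nonneg α _))) (norm_nonneg _)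
  have h4 : ‖(bigLam ε₀)⁻¹ • tableB α z x‖ ≤
      ‖(bigLam ε₀)⁻¹‖ * ((shiftConst α (1, 0, 0) + shiftConst α (0, 1, 0)) * B * B) := by
    rw [norm_smul]
    refine mul_le_mul_of_nonneg_left ((norm_tableB_le α _ _).trans ?_) (norm_nonneg _)
    have hs : 0 ≤ shiftConst α (1, 0, 0) + shiftConst α (0, 1, 0) :=
      add_nonneg (shiftConst_nonneg α _) (shiftConst_nonneg α _)
    exact mul_le_mul (mul_le_mul_of_nonneg_left hz hs) hx (norm_nonneg _) (mul_nonneg hs hB)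
  calc ‖-((1 : ℝ) • x) + tableQ α x + bigLam ε₀ • tableA α y + (bigLam ε₀)⁻¹ • tableB α z x‖
      ≤ ‖-((1 : ℝ) • x)‖ + ‖tableQ α x‖ + ‖bigLam ε₀ • tableA α y‖
          + ‖(bigLam ε₀)⁻¹ • tableB α z x‖ :=
        (norm_add_le _ _).trans (add_le_add ((norm_add_le _ _).trans
          (add_le_add (norm_add_le _ _) le_rfl)) le_rfl)
    _ ≤ _ := add_le_add (add_le_add (add_le_add h1 h2) h3) h4

/-- **CLOSURE OF THE INVISCID ETERNAL LAW UNDER CONTINUOUS LIMITS ON RECEDING HALF-LINES.**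
Let `V_j : ℤ → ℝ → ℝ^m` (`j ∈ ℕ`) satisfy the law of `IsEternal ε₀ α` — `V' = -V + Q(V) + Λ A(V_{·-1}) + Λ⁻¹ B(V_{·+1}, V)`
shell-wise — at every log-time `u > a_j`, with ONE bound `‖V_j n u‖ ≤ B` there, where `a_j → -∞`. If the `V_j`
converge CONTINUOUSLY to `W` (`u_j → σ ⇒ V_j n u_j → W n σ`, every shell), then `W` satisfies the same law at EVERY
`σ ∈ ℝ`. (With `…Extraction.exists_subseq_continuousLimit` this is the ODE half of «type I ⇒ an eternal ω-limit»;
the translates `V_j n u = W̃_{n+d_j}(u + s_j)`, `s_j → ∞`, of a renormalised blow-up `W̃` are the intended input.)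
[cite: Tao2016AveragedNS, §4 Lemma 4.1 (iii) (4.8) in the variables of §6.4; Teschl2012, §2.6 (limits of solutions are solutions); cell vocabulary (`IsEternal`)] -/
theorem eternalLaw_of_continuousLimit {ε₀ : ℝ} {α : Fin m → Fin m → Fin m → ℤ × ℤ × ℤ → ℝ}
    {V : ℕ → ℤ → ℝ → Em m} {a : ℕ → ℝ} {B : ℝ}
    (hlaw : ∀ (j : ℕ) (n : ℤ) (u : ℝ), a j < u → HasDerivAt (V j n)
      (-((1 : ℝ) • V j n u) + tableQ α (V j n u) + bigLam ε₀ • tableA α (V j (n - 1) u)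
        + (bigLam ε₀)⁻¹ • tableB α (V j (n + 1) u) (V j n u)) u)
    (hbd : ∀ (j : ℕ) (n : ℤ) (u : ℝ), a j < u → ‖V j n u‖ ≤ B)
    (ha : Tendsto a atTop atBot) {W : ℤ → ℝ → Em m}
    (hconv : ∀ (n : ℤ) (u : ℕ → ℝ) (σ : ℝ), Tendsto u atTop (𝓝 σ) →
      Tendsto (fun j => V j n (u j)) atTop (𝓝 (W n σ)))
    (n : ℤ) (σ : ℝ) :
    HasDerivAt (W n) (-((1 : ℝ) • W n σ) + tableQ α (W n σ) + bigLam ε₀ • tableA α (W (n - 1) σ)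
        + (bigLam ε₀)⁻¹ • tableB α (W (n + 1) σ) (W n σ)) σ := by
  -- `B ≥ 0` (the half-lines are non-empty)
  have hB : 0 ≤ B := (norm_nonneg _).trans (hbd 0 0 (a 0 + 1) (by linarith))
  -- the uniform bound of the fields
  set K : ℝ := B + shiftConst α (0, 0, 0) * B ^ 2 + ‖bigLam ε₀‖ * (shiftConst α (0, 0, 1) * B ^ 2)
    + ‖(bigLam ε₀)⁻¹‖ * ((shiftConst α (1, 0, 0) + shiftConst α (0, 1, 0)) * B * B) with hKdef
  have hfield : ∀ (j : ℕ) (k : ℤ) (u : ℝ), a j < u →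
      ‖-((1 : ℝ) • V j k u) + tableQ α (V j k u) + bigLam ε₀ • tableA α (V j (k - 1) u)
        + (bigLam ε₀)⁻¹ • tableB α (V j (k + 1) u) (V j k u)‖ ≤ K := fun j k u hu =>
    norm_eternalLaw_rhs_le ε₀ α hB (hbd j k u hu) (hbd j (k - 1) u hu) (hbd j (k + 1) u hu)
  -- pointwise limits (constant sequences)
  have hpt : ∀ (k : ℤ) (u : ℝ), Tendsto (fun j => V j k u) atTop (𝓝 (W k u)) := fun k u =>
    hconv k (fun _ => u) u tendsto_const_nhds
  -- each `V j k` is `K`-Lipschitz on `(a j, ∞)`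
  have hlipV : ∀ (j : ℕ) (k : ℤ) (u v : ℝ), a j < u → u ≤ v → ‖V j k v - V j k u‖ ≤ K * (v - u) := by
    intro j k u v hu huv
    have hderiv : ∀ τ ∈ Icc u v, HasDerivWithinAt (V j k)
        (-((1 : ℝ) • V j k τ) + tableQ α (V j k τ) + bigLam ε₀ • tableA α (V j (k - 1) τ)
          + (bigLam ε₀)⁻¹ • tableB α (V j (k + 1) τ) (V j k τ)) (Icc u v) τ := fun τ hτ =>
      (hlaw j k τ (lt_of_lt_of_le hu hτ.1)).hasDerivWithinAt
    have hbound : ∀ τ ∈ Ico u v,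
        ‖-((1 : ℝ) • V j k τ) + tableQ α (V j k τ) + bigLam ε₀ • tableA α (V j (k - 1) τ)
          + (bigLam ε₀)⁻¹ • tableB α (V j (k + 1) τ) (V j k τ)‖ ≤ K := fun τ hτ =>
      hfield j k τ (lt_of_lt_of_le hu hτ.1)
    exact norm_image_sub_le_of_norm_deriv_le_segment' hderiv hbound v (right_mem_Icc.2 huv)
  -- hence `W k` is `K`-Lipschitz, in particular continuous
  have hlipW : ∀ (k : ℤ) (u v : ℝ), u ≤ v → ‖W k v - W k u‖ ≤ K * (v - u) := by
    intro k u v huv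
    have hev : ∀ᶠ j in atTop, a j < u := ha.eventually (eventually_lt_atBot u)
    exact le_of_tendsto ((hpt k v).sub (hpt k u)).norm (hev.mono fun j hj => hlipV j k u v hj huv)
  have hWcont : ∀ k : ℤ, Continuous (W k) := by
    intro k
    refine (LipschitzWith.of_dist_le_mul (K := K.toNNReal) fun x y => ?_).continuous
    rw [dist_eq_norm, Real.dist_eq]
    rcases le_total x y with hxy | hxy
    · rw [norm_sub_rev, abs_sub_comm, abs_of_nonneg (by linarith)]
      exact (hlipW k x y hxy).trans (mul_le_mul_of_nonneg_right (Real.le_coe_toNNReal K) (by linarith))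
    · rw [abs_of_nonneg (by linarith)]
      exact (hlipW k y x hxy).trans (mul_le_mul_of_nonneg_right (Real.le_coe_toNNReal K) (by linarith))
  -- the limiting field is continuous
  have hΦ : Continuous (fun u => -((1 : ℝ) • W n u) + tableQ α (W n u)
      + bigLam ε₀ • tableA α (W (n - 1) u) + (bigLam ε₀)⁻¹ • tableB α (W (n + 1) u) (W n u)) := by
    have hQ : Continuous (fun u => tableQ α (W n u)) := (continuous_tableQ α).comp (hWcont n)
    have hA : Continuous (fun u => tableA α (W (n - 1) u)) := (continuous_tableA α).comp (hWcont (n - 1))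
    have hBB : Continuous (fun u => tableB α (W (n + 1) u) (W n u)) :=
      continuous_tableB_comp α (hWcont (n + 1)) (hWcont n)
    refine Continuous.add (Continuous.add (Continuous.add ?_ hQ) ?_) ?_
    · exact Continuous.neg (Continuous.const_smul (hWcont n) (1 : ℝ))
    · exact Continuous.const_smul hA (bigLam ε₀)
    · exact Continuous.const_smul hBB ((bigLam ε₀)⁻¹)
  -- the fields along `V j` are continuous on `(a j, ∞)`
  have hcontV : ∀ (j : ℕ) (k : ℤ) (u : ℝ), a j < u → ContinuousAt (V j k) u := fun j k u hu =>
    (hlaw j k u hu).continuousAt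
  have hcontF : ∀ (j : ℕ) (u : ℝ), a j < u → ContinuousAt (fun v => -((1 : ℝ) • V j n v)
      + tableQ α (V j n v) + bigLam ε₀ • tableA α (V j (n - 1) v)
      + (bigLam ε₀)⁻¹ • tableB α (V j (n + 1) v) (V j n v)) u := by
    intro j u hu
    have hQ : ContinuousAt (fun v => tableQ α (V j n v)) u := tendsto_tableQ_comp α (hcontV j n u hu)
    have hA : ContinuousAt (fun v => tableA α (V j (n - 1) v)) u :=
      tendsto_tableA_comp α (hcontV j (n - 1) u hu)
    have hBB : ContinuousAt (fun v => tableB α (V j (n + 1) v) (V j n v)) u :=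
      tendsto_tableB_comp α (hcontV j (n + 1) u hu) (hcontV j n u hu)
    refine ContinuousAt.add (ContinuousAt.add (ContinuousAt.add ?_ hQ) ?_) ?_
    · exact ContinuousAt.neg (ContinuousAt.const_smul (hcontV j n u hu) (1 : ℝ))
    · exact ContinuousAt.const_smul hA (bigLam ε₀)
    · exact ContinuousAt.const_smul hBB ((bigLam ε₀)⁻¹)
  -- pointwise convergence of the fields
  have hFlim : ∀ u : ℝ, Tendsto (fun j => -((1 : ℝ) • V j n u) + tableQ α (V j n u)
      + bigLam ε₀ • tableA α (V j (n - 1) u) + (bigLam ε₀)⁻¹ • tableB α (V j (n + 1) u) (V j n u)) atTop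
      (𝓝 (-((1 : ℝ) • W n u) + tableQ α (W n u) + bigLam ε₀ • tableA α (W (n - 1) u)
        + (bigLam ε₀)⁻¹ • tableB α (W (n + 1) u) (W n u))) := by
    intro u
    have hQ := tendsto_tableQ_comp α (hpt n u)
    have hA := tendsto_tableA_comp α (hpt (n - 1) u)
    have hBB := tendsto_tableB_comp α (hpt (n + 1) u) (hpt n u)
    refine Tendsto.add (Tendsto.add (Tendsto.add ?_ hQ) ?_) ?_
    · exact Tendsto.neg (Tendsto.const_smul (hpt n u) (1 : ℝ))
    · exact Tendsto.const_smul hA (bigLam ε₀)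
    · exact Tendsto.const_smul hBB ((bigLam ε₀)⁻¹)
  -- integral form in the limit
  have hint : ∀ σ₀ σ' : ℝ, σ₀ ≤ σ' →
      ∫ u in σ₀..σ', (-((1 : ℝ) • W n u) + tableQ α (W n u) + bigLam ε₀ • tableA α (W (n - 1) u)
        + (bigLam ε₀)⁻¹ • tableB α (W (n + 1) u) (W n u)) = W n σ' - W n σ₀ := by
    intro σ₀ σ' hle
    have hev : ∀ᶠ j in atTop, a j < σ₀ := ha.eventually (eventually_lt_atBot σ₀)
    -- the integral form of each `V j`, eventually
    have hframe : ∀ᶠ j in atTop,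
        ∫ u in σ₀..σ', (-((1 : ℝ) • V j n u) + tableQ α (V j n u) + bigLam ε₀ • tableA α (V j (n - 1) u)
          + (bigLam ε₀)⁻¹ • tableB α (V j (n + 1) u) (V j n u)) = V j n σ' - V j n σ₀ := by
      refine hev.mono fun j hj => ?_
      refine intervalIntegral.integral_eq_sub_of_hasDerivAt (fun u hu => ?_) ?_
      · rw [uIcc_of_le hle] at hu
        exact hlaw j n u (lt_of_lt_of_le hj hu.1)
      · refine ContinuousOn.intervalIntegrable ?_
        rw [uIcc_of_le hle]
        exact fun u hu => (hcontF j u (lt_of_lt_of_le hj hu.1)).continuousWithinAt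
    -- dominated convergence of the fields
    have hlim : Tendsto (fun j => ∫ u in σ₀..σ', (-((1 : ℝ) • V j n u) + tableQ α (V j n u)
        + bigLam ε₀ • tableA α (V j (n - 1) u) + (bigLam ε₀)⁻¹ • tableB α (V j (n + 1) u) (V j n u))) atTop
        (𝓝 (∫ u in σ₀..σ', (-((1 : ℝ) • W n u) + tableQ α (W n u) + bigLam ε₀ • tableA α (W (n - 1) u)
          + (bigLam ε₀)⁻¹ • tableB α (W (n + 1) u) (W n u)))) := by
      refine intervalIntegral.tendsto_integral_filter_of_dominated_convergence (fun _ => K)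
        ?_ ?_ intervalIntegrable_const ?_
      · refine hev.mono fun j hj => ContinuousOn.aestronglyMeasurable (fun u hu => ?_) measurableSet_uIoc
        rw [Set.uIoc_of_le hle] at hu
        exact (hcontF j u (lt_trans hj hu.1)).continuousWithinAt
      · refine hev.mono fun j hj => ae_of_all _ fun u hu => ?_
        rw [Set.uIoc_of_le hle] at hu
        exact hfield j n u (lt_trans hj hu.1)
      · exact ae_of_all _ fun u _ => hFlim u
    exact tendsto_nhds_unique (hlim.congr' hframe) ((hpt n σ').sub (hpt n σ₀))
  -- FTC-2 at `σ`, from the base point `σ - 1`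
  have hG : HasDerivAt (fun s => W n (σ - 1) + ∫ u in (σ - 1)..s, (-((1 : ℝ) • W n u) + tableQ α (W n u)
      + bigLam ε₀ • tableA α (W (n - 1) u) + (bigLam ε₀)⁻¹ • tableB α (W (n + 1) u) (W n u)))
      (-((1 : ℝ) • W n σ) + tableQ α (W n σ) + bigLam ε₀ • tableA α (W (n - 1) σ)
        + (bigLam ε₀)⁻¹ • tableB α (W (n + 1) σ) (W n σ)) σ := by
    have h := intervalIntegral.integral_hasDerivAt_right (hΦ.intervalIntegrable _ _)
      (hΦ.stronglyMeasurableAtFilter _ _) hΦ.continuousAt (a := σ - 1) (b := σ)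
    exact h.const_add _
  have heq : W n =ᶠ[𝓝 σ] fun s => W n (σ - 1) + ∫ u in (σ - 1)..s, (-((1 : ℝ) • W n u) + tableQ α (W n u)
      + bigLam ε₀ • tableA α (W (n - 1) u) + (bigLam ε₀)⁻¹ • tableB α (W (n + 1) u) (W n u)) := by
    filter_upwards [Ici_mem_nhds (show σ - 1 < σ by linarith)] with s hs
    rw [hint (σ - 1) s hs]
    abel
  exact hG.congr_of_eventuallyEq heq

/-- **The bound passes to a continuous limit**: under the hypotheses of `eternalLaw_of_continuousLimit` (only the
bound, the receding half-lines and pointwise convergence are used), `‖W n σ‖ ≤ B` everywhere — with the law this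
is `UniformBound W` for the limit. [cite: Tao2016AveragedNS, §6.4; cell vocabulary (`UniformBound`)] -/
theorem norm_limit_le_of_receding {V : ℕ → ℤ → ℝ → Em m} {a : ℕ → ℝ} {B : ℝ}
    (hbd : ∀ (j : ℕ) (n : ℤ) (u : ℝ), a j < u → ‖V j n u‖ ≤ B)
    (ha : Tendsto a atTop atBot) {W : ℤ → ℝ → Em m}
    (hconv : ∀ (n : ℤ) (u : ℕ → ℝ) (σ : ℝ), Tendsto u atTop (𝓝 σ) →
      Tendsto (fun j => V j n (u j)) atTop (𝓝 (W n σ)))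
    (n : ℤ) (σ : ℝ) : ‖W n σ‖ ≤ B := by
  have hev : ∀ᶠ j in atTop, a j < σ := ha.eventually (eventually_lt_atBot σ)
  exact le_of_tendsto (hconv n (fun _ => σ) σ tendsto_const_nhds).norm
    (hev.mono fun j hj => hbd j n σ hj)

end BlowupRigidityOne

end Summit.NavierStokesRegularity.NavierStokesRegularity.Theorems

end
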